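import Summits.AnomalousDissipation.AnomalousDissipation.Theses.MarginalStabilityChain
import Literature.Analysis.FluidPDE.StretchedLayerNS

/-!
# Sketch — first lemmas for two round-2 crux ideas on `MarginalStabilityChain.StrainedLayerLaw`
(planner crux-ideate, round 2, ideator k = 5). Statements (`def … : Prop`) plus two small
sorry-free sanity lemmas; nothing conjectural is asserted as a theorem.

* Card `index-gap-quantised-dissipation`: `BurgersLayerKHLongWave` (first lemma, the layer case
  of the INDEX GAP), `alphaRe_cellHarmonic` (ν cancels in the long-wave parameter of the k-th cell
  harmonic — proved), `TerminalValueTransfer` (Cesàro liminf of a convergent dissipation).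
* Card `weak-strain-adiabatic-core`: `cellRescale`, `CellUnits` (first lemma: the ℓ-cell at strain 1
  IS the unit cell at weak strain γ' = ℓ and viscosity ν/ℓ), `CellUnitsDissipation`,
  `spinUp_summable`-type arithmetic (proved: the adiabatic error budget is a convergent integral).
-/

noncomputable section

set_option linter.dupNamespace false

open MeasureTheory Set Filter Topology
open scoped ENNReal
open Literature.Analysis.FluidPDE Literature.Analysis.FluidPDE.StretchedLayer

namespace Summit.AnomalousDissipation.AnomalousDissipation.Cruxes.StrainedLayerLaw.SketchK5

/-! ## Card B — index gap / quantised terminal dissipation -/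

/-- **B1 · long-wave Kelvin–Helmholtz instability of the exact Burgers layer, UNIFORM in the
wavenumber** (the layer case of the index gap; same operator, class and normalisation as the
route's PROVED crux `BurgersLayerKH` (3008), whose witness fixes ONE small `α₀`): there are
`α₁, h₀, c₁ > 0` such that for every `α ∈ (0, α₁]` and every `Re` with `h := 1/(α Re) ≤ h₀` the
linearised stretched-vorticity operator about `U(y) = ∫₀ʸ e^{-s²/2} ds` has a Gaussian-class eigenmode
with `re σ ≥ c₁ · α · Re` (vortex-sheet rate `√(π/2)·αRe`, expected `c₁ = 3√(π/2)/4`). For the k-th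
harmonic of a cell of period `ℓ` at viscosity `ν` one has `α = 2πk√ν/ℓ → 0` and
`α·Re = √(2π) k/ℓ` INDEPENDENT of `ν` (`alphaRe_cellHarmonic`), so `h = ℓ/(√(2π) k) ≤ h₀` iff the
physical wavelength `ℓ/k ≤ √(2π) h₀ =: ℓ₀`: every harmonic with wavelength `≤ ℓ₀` is unstable for ALL
small `ν`, with growth `≥ c₁√(2π) k/ℓ` in strain units. What is missing from the landed 3008 stubs:
the smallness `h ≤ h₀(α, ε)` of `StrainedPackage α ε` must be made uniform in `α ∈ (0, α₁]`. -/
def BurgersLayerKHLongWave : Prop :=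
  ∃ α₁ h₀ c₁ : ℝ, 0 < α₁ ∧ 0 < h₀ ∧ 0 < c₁ ∧ ∀ α Re : ℝ, 0 < α → α ≤ α₁ → 0 < Re →
    1 ≤ α * Re * h₀ →
    ∃ (σ : ℂ) (ψ : ℝ → ℂ), let U : ℝ → ℝ := fun y => ∫ s in (0:ℝ)..y, Real.exp (-(s ^ 2) / 2); let U'' : ℝ → ℝ := fun y => -(y * Real.exp (-(y ^ 2) / 2)); let ω : ℝ → ℂ := fun y => -(iteratedDeriv 2 ψ y - (α : ℂ) ^ 2 * ψ y); c₁ * (α * Re) ≤ σ.re ∧ ContDiff ℝ 4 ψ ∧ (∃ y, ψ y ≠ 0) ∧ Filter.Tendsto ψ Filter.atTop (nhds 0) ∧ Filter.Tendsto ψ Filter.atBot (nhds 0) ∧ (∃ C : ℝ, ∀ y : ℝ, ‖ω y‖ ≤ C * Real.exp (-(y ^ 2) / 4)) ∧ ∀ y : ℝ, σ * ω y = -(Complex.I * α * Re) * ((U y : ℂ) * ω y + (U'' y : ℂ) * ψ y) + ω y + (y : ℂ) * deriv ω y + iteratedDeriv 2 ω y - (α : ℂ) ^ 2 * ω y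

/-- **ν cancels in the long-wave parameter.** In the similarity units of `BurgersLayerKH`
(lengths `δ = √ν`, `Re = 1/√(2πν)` for `γ = ΔU = 1`) the k-th harmonic of the `ℓ`-cell has
wavenumber `α = 2πk√ν/ℓ`, and `α·Re = √(2π)·k/ℓ`: the strained persistence parameter
`h = 1/(αRe) = ℓ/(√(2π)k)` depends on the physical wavelength only. -/
theorem alphaRe_cellHarmonic (k ℓ ν : ℝ) (hℓ : 0 < ℓ) (hν : 0 < ν) :
    (2 * Real.pi * k * Real.sqrt ν / ℓ) * (1 / Real.sqrt (2 * Real.pi * ν)) =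
      Real.sqrt (2 * Real.pi) * k / ℓ := by
  have hπ : 0 < Real.pi := Real.pi_pos
  have h1 : Real.sqrt (2 * Real.pi * ν) = Real.sqrt (2 * Real.pi) * Real.sqrt ν :=
    Real.sqrt_mul (by positivity) ν
  have h2 : Real.sqrt (2 * Real.pi) ^ 2 = 2 * Real.pi := Real.sq_sqrt (by positivity)
  have hsν : 0 < Real.sqrt ν := Real.sqrt_pos.2 hν
  have hs2 : 0 < Real.sqrt (2 * Real.pi) := Real.sqrt_pos.2 (by positivity)
  rw [h1]
  field_simp
  linear_combination (-k) * h2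

/-- **B4 · terminal-value transfer** (Cesàro liminf of a dissipation that CONVERGES): if the slice
dissipation `D(t)` has locally finite integrals and tends to `d` as `t → ∞`, the crux's
`liminf_T ofReal(T⁻¹)·∫⁻_{(0,T]} D` equals `d`. This is all the time-averaging the index-gap line
needs: `ν`-uniformity enters only through the VALUE `d = D(e)` of the limiting equilibrium `e`. -/
def TerminalValueTransfer : Prop :=
  ∀ (D : ℝ → ℝ≥0∞) (d : ℝ≥0∞), Measurable D → d ≠ ⊤ →
    (∀ T : ℝ, 0 < T → ∫⁻ t in Ioc 0 T, D t ≠ ⊤) → Tendsto D atTop (𝓝 d) →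
    Filter.liminf (fun T : ℝ => ENNReal.ofReal T⁻¹ * ∫⁻ t in Ioc 0 T, D t) atTop = d

/-- The dissipation spectrum of the equilibrium zoo is QUANTISED (arithmetic of Disproof §3
`row_dissipation_per_area`): an `N`-row in the `ℓ`-cell dissipates `ℓ/(8πN)` per unit area to leading
order, so the index-≤1 states (`N = 1, 2`) sit at `ℓ/8π, ℓ/16π` and every `N ≥ 3` row at `≤ ℓ/24π`;
the card's universal constant `c = 1/(20π)` lies strictly inside the gap. -/
theorem gap_arith (ℓ : ℝ) (hℓ : 0 < ℓ) :
    ℓ / (24 * Real.pi) < ℓ / (20 * Real.pi) ∧ ℓ / (20 * Real.pi) < ℓ / (16 * Real.pi) := by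
  have hπ : 0 < Real.pi := Real.pi_pos
  constructor
  · apply div_lt_div_of_pos_left hℓ (by positivity); nlinarith
  · apply div_lt_div_of_pos_left hℓ (by positivity); nlinarith

/-! ## Card A — weak-strain cell: adiabatic core -/

/-- Cell units: rescale `(t, x, y) ↦ (ℓT, ℓX, ℓY)` (velocities and pressure unchanged). -/
def cellRescale (ℓ : ℝ) (f : ℝ → ℝ → ℝ → ℝ) : ℝ → ℝ → ℝ → ℝ :=
  fun T X Y => f (ℓ * T) (ℓ * X) (ℓ * Y)

/-- **A1 · the ℓ-cell at unit strain IS the unit cell at WEAK strain `γ' = ℓ` and viscosity `ν/ℓ`**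
(first lemma of card A; exact scaling covariance of the Literature class
`IsStretchedLayerNSSolutionOn S ν γ ΔU L`: `(ν, γ, ΔU, L) = (ν, 1, 1, ℓ) ↔ (ν/ℓ, ℓ, 1, 1)` under
`cellRescale ℓ`; multiply each equation by `ℓ`). Consequently the crux's floor `c·min(ℓ,1) = c·ℓ`
for `ℓ ≤ 1` reads, in cell units, `D' ≥ c·γ'`: a LINEAR RESPONSE of the long-time dissipation to a
weak strain, with the unstrained (`γ' = 0`) Kelvin–Stuart cat's-eye vortex as the `γ' → 0` limit
object. -/
def CellUnits : Prop :=
  ∀ ν ℓ : ℝ, 0 < ν → 0 < ℓ → ∀ u v p : ℝ → ℝ → ℝ → ℝ,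
    IsStretchedLayerNSSolutionOn (Ioi 0) ν 1 1 ℓ u v p ↔
      IsStretchedLayerNSSolutionOn (Ioi 0) (ν / ℓ) ℓ 1 1 (cellRescale ℓ u) (cellRescale ℓ v)
        (cellRescale ℓ p)

/-- **A1' · the dissipation per unit area is INVARIANT under the cell rescaling**
(`(ν/ℓ)/1 · ∫∫ ℓ²|∇u|² dXdY = (ν/ℓ)∫∫|∇u|² dxdy`): `layerDissipation (ν/ℓ) 1` of the rescaled slice at
cell time `T = t/ℓ` equals `layerDissipation ν ℓ` of the original slice at time `t`; Cesàro means in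
`T` and in `t` coincide, so `meanLayerDissipation` is invariant too. -/
def CellUnitsDissipation : Prop :=
  ∀ ν ℓ t : ℝ, 0 < ν → 0 < ℓ → ∀ u v : ℝ → ℝ → ℝ → ℝ,
    layerDissipation (ν / ℓ) 1 (cellRescale ℓ u (t / ℓ)) (cellRescale ℓ v (t / ℓ)) =
      layerDissipation ν ℓ (u t) (v t)

/-- **A3 · the adiabatic error budget converges** (why INFINITE time is reachable ν-uniformly along
the squeeze): a core of cell-scale radius `a(t)² = a₀² e^{-t}` compressed at unit rate spins at
`Ω(t) = Γ/(2π a(t)²)`; second-order averaging errors accrue at rate `(γ/Ω)² = (2π a₀² e^{-t}/Γ)²`,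
whose integral over `[0, ∞)` is FINITE (`= (2πa₀²/Γ)²/2`): the arithmetic below is the
`∫₀^∞ e^{-2t} dt`-type bound `∫₀ᵀ K² e^{-2t} ≤ K²/2` in closed form. -/
theorem adiabatic_budget (K T : ℝ) :
    K ^ 2 * ((1 - Real.exp (-2 * T)) / 2) ≤ K ^ 2 / 2 := by
  have h1 : 0 < Real.exp (-2 * T) := Real.exp_pos _
  have hK : 0 ≤ K ^ 2 := sq_nonneg K
  nlinarith [mul_nonneg hK h1.le]

end Summit.AnomalousDissipation.AnomalousDissipation.Cruxes.StrainedLayerLaw.SketchK5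

end
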